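import Summits.ValiantsHypothesis.ValiantsHypothesis.Theorems.KPlusLogSqLawValuativeDoorGenTwoSidon
import Summits.ValiantsHypothesis.ValiantsHypothesis.Theorems.KPlusLogSqLawValuativeDoorGenTwoUnitTwo

/-!
# LINE `valuative_door` (crux `WeakLifting`, stmt-ValiantsHypothesis-19561) — the GENERAL width-two Sidon row when `v 2 = 1`:
# a general `2 × 2` lacunary pencil with `K ≥ 3` letters on a Sidon support has `npEdges ≤ 4K − 7` (residue characteristic ≠ 2)

HONEST FRAMING.  Helper (cell `pub-symmetroid`, seat val-sym-lift-p1 g23, 2026-08-29; `--supports 19561 --as helper`).  Sharpening of the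
all-field general row `…GenTwoSidon.valGenSidonTwo_unfolded` (`npEdges ≤ 5K − 11`) under the extra hypothesis `v 2 = 1` (every
non-archimedean field of residue characteristic `≠ 2`, e.g. `ℚ_p` for odd `p`, function fields in characteristic `0`; NOT the 2-adic place of
`ℝ`): the dominant off-diagonal pairs have no three pairwise nested members (`…GenTwoSidon.not_three_nested_dominant_gen_of_sidon`) AND a
dominant diagonal exponent never sits strictly inside the inner pair of two nested dominant pairs
(`…GenTwoUnitTwo.not_nestedDiag_dominant_gen_of_sidon`), so by the two-copy count `…GenTwoUnitTwo.card_pairs_add_diag_le` at most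
`(2K − 1) + (2K − 5) = 4K − 6` exponents are dominant: `npEdges ≤ 4K − 7` for `K ≥ 3` (`valGenSidonTwo_unitTwo_unfolded`; `K = 3, 4`: the
trivial `5, 9`; content from `K = 5`: `13 < 14`).  Located: `4K − 6` dominant exponents are attained in the cancellation-free model for
`K = 5, 6` (seat `exp/tropgen.py`), so the constant is located-sharp where it applies; residue characteristic `2` is NOT covered (there only
`5K − 11` is kernel).  Calibration only; no bearing on vW / vB, `TropicalB`, `MatrixDescartes` (18050) or VP ≠ VNP.  [elementary]
-/

set_option linter.dupNamespace false
set_option autoImplicit false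

namespace Summit.ValiantsHypothesis.ValiantsHypothesis.Theorems.KPlusLogSqLaw.ValDoor

open Polynomial Finset Matrix
open scoped BigOperators Classical

variable {F : Type*} [Field F]

/-! ## §1 Sorted letters -/

/-- **at most `(2K − 1) + (2K − 5)` dominant exponents** for a general `2 × 2` Sidon pencil with strictly increasing exponents when
`v 2 = 1`. [assembly of the two obstructions and the two-copy count] -/
theorem domCount_le_of_sidon_sorted_gen_unitTwo (v : AbsoluteValue F ℝ) (hv : IsNonarchimedean v) (hv2 : v 2 = 1) {K : ℕ}
    (d : Fin K → ℕ) (hd : StrictMono d) (M : Fin K → Matrix (Fin 2) (Fin 2) F)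
    (hsid : ∀ l₁ l₂ l₃ l₄ : Fin K, d l₁ + d l₂ = d l₃ + d l₄ → (l₁ = l₃ ∧ l₂ = l₄) ∨ (l₁ = l₄ ∧ l₂ = l₃)) :
    ((Matrix.det (∑ l, ((X : F[X]) ^ d l) • (M l).map (C : F →+* F[X]))).support.filter fun E =>
        ∃ r : ℝ, 0 < r ∧ ∀ E' ∈ (Matrix.det (∑ l, ((X : F[X]) ^ d l) • (M l).map (C : F →+* F[X]))).support, E' ≠ E →
          v ((Matrix.det (∑ l, ((X : F[X]) ^ d l) • (M l).map (C : F →+* F[X]))).coeff E') * r ^ E'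
            < v ((Matrix.det (∑ l, ((X : F[X]) ^ d l) • (M l).map (C : F →+* F[X]))).coeff E) * r ^ E).card
      ≤ (2 * K - 1) + (2 * K - 5) := by
  set f : F[X] := Matrix.det (∑ l, ((X : F[X]) ^ d l) • (M l).map (C : F →+* F[X])) with hf
  set D := f.support.filter fun E => ∃ r : ℝ, 0 < r ∧ ∀ E' ∈ f.support, E' ≠ E →
      v (f.coeff E') * r ^ E' < v (f.coeff E) * r ^ E with hD
  set P : Finset (Fin K × Fin K) := (univ : Finset (Fin K × Fin K)).filter fun p => p.1 < p.2 ∧ d p.1 + d p.2 ∈ D with hP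
  set Q : Finset (Fin K) := (univ : Finset (Fin K)).filter fun b => d b + d b ∈ D with hQ
  have hcover : D ⊆ P.image (fun p => d p.1 + d p.2) ∪ Q.image (fun b => d b + d b) := by
    intro E hE
    have hEsupp : E ∈ f.support := (Finset.mem_filter.1 hE).1
    have hne := Polynomial.mem_support_iff.1 hEsupp
    rw [hf, coeff_det_genPencil_two d M E] at hne
    obtain ⟨p, hp, -⟩ := Finset.exists_ne_zero_of_sum_ne_zero hne
    obtain ⟨-, hpE⟩ := Finset.mem_filter.1 hp
    rw [Finset.mem_union]
    rcases lt_trichotomy p.1 p.2 with h | h | h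
    · left
      refine Finset.mem_image.2 ⟨(p.1, p.2), Finset.mem_filter.2 ⟨Finset.mem_univ _, h, ?_⟩, hpE⟩
      rw [hpE]; exact hE
    · right
      refine Finset.mem_image.2 ⟨p.1, Finset.mem_filter.2 ⟨Finset.mem_univ _, ?_⟩, by rw [← hpE, h]⟩
      have : d p.1 + d p.1 = E := by rw [← hpE, h]
      rw [this]; exact hE
    · left
      refine Finset.mem_image.2 ⟨(p.2, p.1), Finset.mem_filter.2 ⟨Finset.mem_univ _, h, ?_⟩, by rw [← hpE, Nat.add_comm]⟩
      show d p.2 + d p.1 ∈ D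
      rw [Nat.add_comm, hpE]; exact hE
  have hno3 : ∀ p ∈ P, ∀ p' ∈ P, ∀ q ∈ P, ¬ (p.1 < p'.1 ∧ p'.1 < q.1 ∧ q.2 < p'.2 ∧ p'.2 < p.2) := by
    intro p hp p' hp' q hq hnest
    obtain ⟨-, -, hpD⟩ := Finset.mem_filter.1 hp
    obtain ⟨-, -, hp'D⟩ := Finset.mem_filter.1 hp'
    obtain ⟨-, hq12, hqD⟩ := Finset.mem_filter.1 hq
    refine not_three_nested_dominant_gen_of_sidon v hv d M hsid (hd hnest.1) (hd hnest.2.1) (hd hq12) (hd hnest.2.2.1)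
      (hd hnest.2.2.2) fun E hE => ?_
    simp only [Finset.mem_insert, Finset.mem_singleton] at hE
    rcases hE with rfl | rfl | rfl
    · exact Finset.mem_filter.1 hpD
    · exact Finset.mem_filter.1 hp'D
    · exact Finset.mem_filter.1 hqD
  have hQ' : ∀ b ∈ Q, ∀ p ∈ P, ∀ q ∈ P, ¬ (p.1 < q.1 ∧ q.1 < b ∧ b < q.2 ∧ q.2 < p.2) := by
    intro b hb p hp q hq hnest
    obtain ⟨-, hbD⟩ := Finset.mem_filter.1 hb
    obtain ⟨-, -, hpD⟩ := Finset.mem_filter.1 hp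
    obtain ⟨-, -, hqD⟩ := Finset.mem_filter.1 hq
    refine not_nestedDiag_dominant_gen_of_sidon v hv hv2 d M hsid (hd hnest.1) (hd hnest.2.1) (hd hnest.2.2.1) (hd hnest.2.2.2)
      fun E hE => ?_
    simp only [Finset.mem_insert, Finset.mem_singleton] at hE
    rcases hE with rfl | rfl | rfl
    · exact Finset.mem_filter.1 hpD
    · exact Finset.mem_filter.1 hqD
    · exact Finset.mem_filter.1 hbD
  have hPQ : P.card + Q.card ≤ (2 * K - 1) + (2 * K - 5) :=
    card_pairs_add_diag_le P Q (fun p hp => (Finset.mem_filter.1 hp).2.1) hno3 hQ'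
  calc D.card ≤ (P.image (fun p => d p.1 + d p.2) ∪ Q.image (fun b => d b + d b)).card := Finset.card_le_card hcover
    _ ≤ (P.image fun p => d p.1 + d p.2).card + (Q.image fun b => d b + d b).card := Finset.card_union_le _ _
    _ ≤ P.card + Q.card := Nat.add_le_add Finset.card_image_le Finset.card_image_le
    _ ≤ (2 * K - 1) + (2 * K - 5) := hPQ

/-! ## §2 The row, unfolded -/

/-- **THE GENERAL WIDTH-TWO SIDON ROW WHEN `v 2 = 1`, UNFOLDED:** over a field of characteristic zero with a non-archimedean absolute value
`v` satisfying `v 2 = 1`, every `2 × 2` lacunary pencil `Σ_l X^{d_l} M_l` (ARBITRARY letters) with `K ≥ 3` letters on a SIDON support has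
`npEdges ≤ 4K − 7` (binders of `GenValRootLawAt 2 K (4 * K - 7)` plus the Sidon hypothesis and `v 2 = 1`).
[three-nested exclusion + nested-diagonal exclusion + two-copy count] -/
theorem valGenSidonTwo_unitTwo_unfolded :
    ∀ (F : Type) [Field F] [CharZero F] (v : AbsoluteValue F ℝ), IsNonarchimedean v → v 2 = 1 →
      ∀ (K : ℕ), 3 ≤ K → ∀ (d : Fin K → ℕ) (M : Fin K → Matrix (Fin 2) (Fin 2) F),
        (∀ l₁ l₂ l₃ l₄ : Fin K, d l₁ + d l₂ = d l₃ + d l₄ → (l₁ = l₃ ∧ l₂ = l₄) ∨ (l₁ = l₄ ∧ l₂ = l₃)) →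
        ((Matrix.det (∑ l, ((Polynomial.X : Polynomial F) ^ d l) • (M l).map Polynomial.C)).support.filter fun E =>
            ∃ r : ℝ, 0 < r ∧ ∀ E' ∈ (Matrix.det (∑ l, ((Polynomial.X : Polynomial F) ^ d l) • (M l).map Polynomial.C)).support,
              E' ≠ E →
              v ((Matrix.det (∑ l, ((Polynomial.X : Polynomial F) ^ d l) • (M l).map Polynomial.C)).coeff E') * r ^ E'
                < v ((Matrix.det (∑ l, ((Polynomial.X : Polynomial F) ^ d l) • (M l).map Polynomial.C)).coeff E) * r ^ E).card - 1
          ≤ 4 * K - 7 := by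
  intro F _ _ v hv hv2 K hK d M hsid
  have hdinj : Function.Injective d := by
    intro i j hij
    rcases hsid i i i j (by rw [hij]) with ⟨-, h⟩ | ⟨h, -⟩
    · exact h
    · exact h
  set σ : Equiv.Perm (Fin K) := Tuple.sort d with hσ
  have hmono : StrictMono (d ∘ σ) := (Tuple.monotone_sort d).strictMono_of_injective (hdinj.comp σ.injective)
  have hsid' : ∀ l₁ l₂ l₃ l₄ : Fin K, (d ∘ σ) l₁ + (d ∘ σ) l₂ = (d ∘ σ) l₃ + (d ∘ σ) l₄ →
      (l₁ = l₃ ∧ l₂ = l₄) ∨ (l₁ = l₄ ∧ l₂ = l₃) := by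
    intro l₁ l₂ l₃ l₄ h
    rcases hsid _ _ _ _ h with ⟨h1, h2⟩ | ⟨h1, h2⟩
    · exact Or.inl ⟨σ.injective h1, σ.injective h2⟩
    · exact Or.inr ⟨σ.injective h1, σ.injective h2⟩
  have hf' : Matrix.det (∑ l, ((X : F[X]) ^ (d ∘ σ) l) • (M (σ l)).map (C : F →+* F[X]))
      = Matrix.det (∑ l, ((X : F[X]) ^ d l) • (M l).map (C : F →+* F[X])) :=
    congrArg Matrix.det (Equiv.sum_comp σ (fun l => ((X : F[X]) ^ d l) • (M l).map (C : F →+* F[X])))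
  have h := domCount_le_of_sidon_sorted_gen_unitTwo v hv hv2 (d ∘ σ) hmono (fun l => M (σ l)) hsid'
  rw [hf'] at h
  omega

end Summit.ValiantsHypothesis.ValiantsHypothesis.Theorems.KPlusLogSqLaw.ValDoor
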